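/-
Copyright (c) 2026 the pub-hodgecm-mathlib formalisation cell (harness21).  Prover seat hodgecm-mathlib-LH4-p13 (g6): Track A «(D-RAM) FOUR-FRAME» squad of crux H413,
unit U2H (ii-H), census leaf (ρ2b′-X) — socket (B) (type RamK bottom; lead LH4-p07 (g7)), organ (B-dK): THE EISENSTEIN DEPTH `dK = d` ON TYPE RamK, 2026-09-04.
-/
import Summits.HodgeConjecture.HodgeConjecture.Theorems.F0P3cDyRamKleinDifferentLetters   -- ★ p858036∕p858053 (F0P3a-p01 (g34)): `v_sub_map_eq_of_uniformizer`; brings ★ `WildQuadraticDatumTrace`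
import Literature.NumberTheory.Automorphic.UnitaryThreeFourFrameDefs                      -- ★ `IsRamifiedQuadraticDatum`
import HarnessLib

/-!
# F0 · P3c · line LH4 «(D-RAM) FOUR-FRAME» — socket (B), organ (B-dK): the Eisenstein depth `dK = d` on type RamK
(Serre 1979 Ch. IV §1, Ch. III §6; Rogawski 1990 §4.9)

Cell `pub/hodgecm-mathlib`, crux H413 = `stmt-HodgeConjecture-24833` (helper lane, count-neutral); THEOREMS ONLY (no definition, no instance, no notation, no named
fact, no `sorry`).  ONE-FIELD letters: `K` (= the third field `M` of the (ρ2b′-X) line models) with `IsRamifiedQuadraticDatum Θ ϖ d t` (type RamK: `M ∕ M^Θ` ramified with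
the letters `d, t` of `L_w ∕ L⁺_v`), and an isometric `ρ` (the involution with fixed field `E = L_w`).

WHAT IS PROVED (towards the socket-(B) organ (B-dK) of LH4-p07 (g7)'s Compose v4, LEAD LINE #5 — owner LH4-p12 (g5) by the payer's word 07:12:17Z; this file is the closed
core lemma in `r`-letters, offered as a helper).
* (§1 is ★ already: F0P3a-p01 (g34)'s `KleinDifferentLetters.v_sub_map_eq_of_uniformizer` — `Θ` moves EVERY uniformiser of `M` by exactly `|ϖ|^d`; imported, not restated.)
* §2 **`dK_eq_of_eisenstein`** — if `uF, wF` are `Θ`-fixed, `uF` is `ρ`-fixed, `ρr = −r`, `r² = uF² + 4wF`, `|wF| = exp(−2)` and `|uF² + 4wF| = exp(−2dK)` (the H-side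
  Eisenstein datum `x² − uF·x − wF` of ★ p09 `hSide_closedForm_of_tube_exists`, read in `M`), then **`dK = d`**: `π := (uF + r)∕2` is a uniformiser of `M` (`π·ρπ = −wF`);
  `Θr = ±r`, and `Θr = r` would make `π` a `Θ`-fixed element of ODD valuation (datum clause 4) — this is «the descent field is not the unramified `K♮`»; so `π − Θπ = r`
  and ★ `v_sub_map_eq_of_uniformizer` gives `|r| = exp(−d)`, while `|r|² = exp(−2dK)`.

HONEST LABEL: HC_CM is proved only modulo the 7 printed citations (2 remaining named inputs: hLiu418 = stmt-HodgeConjecture-24832, h413 = stmt-HodgeConjecture-24833) until rung 0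
closes; (ρ2b′-X) :418 is an OPEN prover target — this file is a helper (`--supports`), proofs only; socket (B) is OPEN (lead LH4-p07 (g7) composes).

## References
* [Serre1979] J.-P. Serre, *Local Fields*, GTM 67 (1979), Ch. IV §1 Prop. 1 and Lemma 1 (`i_G` via any generator), Ch. III §6 Prop. 13.
* [Rogawski1990] J. D. Rogawski, *Automorphic Representations of Unitary Groups in Three Variables*, Ann. of Math. Stud. 123 (1990), §4.9 pp. 55–56.
-/

set_option autoImplicit false

noncomputable section

open WithZero

namespace Summit.HodgeConjecture.HodgeConjecture.Cruxes.H413.F0P3cDyRamEisensteinDepthRamK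

open Literature.NumberTheory.Automorphic.UnitaryThreeFourFrame (IsRamifiedQuadraticDatum)
open Literature.NumberTheory.LocalFields.WildQuadraticDatum (v_varpi_pow)
open Summit.HodgeConjecture.HodgeConjecture.Cruxes.H413.F0P3cDyRamKleinDifferentLetters (v_sub_map_eq_of_uniformizer)

variable {K : Type} [Field K] [Valued K ℤᵐ⁰] {Θ : K →+* K} {ϖ : K} {d t : ℕ}

/-! ## The Eisenstein depth of the descended element equals `d` -/

/-- In `ℤᵐ⁰`: `a·a = exp(2k)` forces `a = exp k`. [folklore] -/
theorem eq_exp_of_mul_self_eq {a : ℤᵐ⁰} {k : ℤ} (h : a * a = exp (2 * k)) : a = exp k := by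
  have ha0 : a ≠ 0 := fun h0 => by rw [h0, zero_mul] at h; exact (exp_ne_zero h.symm).elim
  rw [← exp_log ha0] at h ⊢
  rw [← exp_add, exp_inj] at h
  rw [exp_inj]; omega

/-- **`dK = d` ON TYPE RamK.**  Datum `(K, Θ, ϖ, d, t)`, an isometric `ρ`; `uF, wF` fixed by `Θ`, `uF` fixed by `ρ`, `ρr = −r`, `r² = uF² + 4wF`, `|wF| = exp(−2)` (the
Eisenstein constant term, a uniformiser of `F`) and `|uF² + 4wF| = exp(−2dK)` (the Eisenstein discriminant).  Then `dK = d`.  `π := (uF + r)∕2` has `ρπ = uF − π`,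
`π·ρπ = −wF`, hence `|π| = exp(−1)`; `(Θr)² = r²` gives `Θr = ±r`; `Θr = r` makes `π` `Θ`-fixed of odd valuation (clause 4 ✗); `Θr = −r` gives `π − Θπ = r`, so by ★
`v_sub_map_eq_of_uniformizer` (g34) `|r| = exp(−d)`, and `|r|² = exp(−2dK)`. [cite: Serre1979, Ch. IV §1 Prop. 1] [cite: Serre1979, Ch. III §6 Prop. 13] [cite: Rogawski1990, §4.9 pp. 55–56] -/
theorem dK_eq_of_eisenstein (hD : IsRamifiedQuadraticDatum Θ ϖ d t) {ρ : K →+* K} (hvρ : ∀ z, Valued.v (ρ z) = Valued.v z)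
    {uF wF r : K} (hΘu : Θ uF = uF) (hΘw : Θ wF = wF) (hρu : ρ uF = uF) (hρr : ρ r = -r)
    (hr2 : r ^ 2 = uF ^ 2 + 4 * wF) (hw : Valued.v wF = exp (-2 : ℤ))
    {dK : ℕ} (hΔ : Valued.v (uF ^ 2 + 4 * wF) = exp (-(2 * (dK : ℤ)))) : dK = d := by
  have hD' := hD
  obtain ⟨hΘΘ, hΘv, hϖ, heven, hdϖ, -, h2t⟩ := hD'
  have h20 : (2 : K) ≠ 0 := by
    intro h0
    rw [h0, map_zero, v_varpi_pow hϖ] at h2t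
    exact (exp_ne_zero h2t.symm).elim
  -- the uniformiser `π := (uF + r)∕2`
  set π : K := (uF + r) / 2 with hπdef
  have hρπ : ρ π = uF - π := by
    rw [hπdef, map_div₀, map_add, hρu, hρr, map_ofNat]; field_simp; ring
  have hππ : π * ρ π = -wF := by
    rw [hρπ, hπdef]
    field_simp
    linear_combination (-1 : K) * hr2
  have hvπ : Valued.v π = exp (-1 : ℤ) := by
    apply eq_exp_of_mul_self_eq (k := -1)
    have h := congrArg Valued.v hππ
    rw [Valuation.map_mul, hvρ, Valuation.map_neg, hw] at h
    rw [h]; rfl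
  -- `Θr = ±r`
  have hΘr2 : (Θ r - r) * (Θ r + r) = 0 := by
    have h : Θ (r ^ 2) = r ^ 2 := by rw [hr2, map_add, map_mul, map_pow, map_ofNat, hΘu, hΘw]
    rw [map_pow] at h
    linear_combination h
  rcases mul_eq_zero.1 hΘr2 with hfix | hanti
  · -- `Θr = r`: `π` would be a `Θ`-fixed element of odd valuation
    exfalso
    have hΘπ : Θ π = π := by rw [hπdef, map_div₀, map_add, hΘu, sub_eq_zero.1 hfix, map_ofNat]
    have hπ0 : π ≠ 0 := fun h0 => by rw [h0, map_zero] at hvπ; exact (exp_ne_zero hvπ.symm).elim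
    obtain ⟨n, hn⟩ := heven π hΘπ hπ0
    rw [hn, exp_inj] at hvπ
    omega
  · -- `Θr = −r`: `π − Θπ = r`, a uniformiser difference of valuation `exp(−d)`
    have hΘr : Θ r = -r := by linear_combination hanti
    have hπΘ : π - Θ π = r := by
      rw [hπdef, map_div₀, map_add, hΘu, hΘr, map_ofNat]; field_simp; ring
    have hvr : Valued.v r = exp (-(d : ℤ)) := by
      rw [← hπΘ, v_sub_map_eq_of_uniformizer hΘΘ hΘv heven hϖ hdϖ (by rw [hvπ, hϖ]), v_varpi_pow hϖ]
    have h2 : Valued.v (r ^ 2) = exp (-(2 * (dK : ℤ))) := by rw [hr2, hΔ]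
    rw [Valuation.map_pow, hvr, ← exp_nsmul, exp_inj, nsmul_eq_mul] at h2
    push_cast at h2
    omega

end Summit.HodgeConjecture.HodgeConjecture.Cruxes.H413.F0P3cDyRamEisensteinDepthRamK

end
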